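import Literature.AlgebraicGeometry.HodgeTheory.CotangentSheafPullbackHomCharts
import Literature.AlgebraicGeometry.HodgeTheory.HodgeSheafPullbackForms
import Literature.AlgebraicGeometry.Modules.BiprodSections
import Literature.Algebra.Derivations.KaehlerDifferentialTensorProduct
import HarnessLib

/-!
# The product formula for `Ω¹` on an affine product chart: `(df, dg) : f^*Ω¹_Y ⊕ g^*Ω¹_Z → Ω¹_P` is
# bijective on `Γ(W, –)` when `Γ(W) = Γ(U) ⊗_k Γ(V)`

Layer `Literature/AlgebraicGeometry/Motives`; theorems only (no `def`, no named fact, no instance, no notation).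
Cell `pub-hodge-ring2`, crux stmt-HodgeConjecture-26512, route BLR-absolute for the named fact
`Motives.Mumford1970_cotangentSheaf_abelianVariety_free`, captain's step «F2b»; research route conditional on HC_CM;
not a corollary.

Let `k` be a commutative ring, `f : P ⟶ Y`, `g : P ⟶ Z` morphisms of `k`-schemes (`Over (Spec k)`; no limit hypothesis),
`U ⊆ Y`, `V ⊆ Z`, `W ⊆ P` AFFINE opens with `W ⊆ f⁻¹U ∩ g⁻¹V`, and write `A = Γ(U, 𝒪_Y)`, `B = Γ(V, 𝒪_Z)`,
`T = Γ(W, 𝒪_P)` with their `k`-algebra structures from the structure morphisms (`Motives.constToPresheaf`) and the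
`A`-, `B`-algebra structures of `T` through `f♯_{U→W}`, `g♯_{V→W}` (`Scheme.Hom.appLE`). **If `T` is a pushout
`A ⊗_k B` (`Algebra.IsPushout k A B T`) — e.g. `W = U ×_k V` a product chart of `P = Y ×_k Z` — then the sum map
`Γ(W, f^*Ω¹_Y) × Γ(W, g^*Ω¹_Z) → Γ(W, Ω¹_P)`, `(x, y) ↦ df(x) + dg(y)`, is BIJECTIVE**
(`bijective_pullbackHom_app_add_pullbackHom_app`), hence so is `(biprod.desc (df) (dg))_W`
(`bijective_biprod_desc_pullbackHom_app`; `Modules/BiprodSections.bijective_biprod_desc_app_iff`).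

This is the sectionwise content of the product formula `pr₁^*Ω¹_{Y/k} ⊕ pr₂^*Ω¹_{Z/k} ≅ Ω¹_{Y ×_k Z/k}` (Liu, *Algebraic
Geometry and Arithmetic Curves*, §6.1 Exercise 1.5 (b); EGA IV 16.4.23; Hartshorne II Ex. 8.3-type), read on the affine
pieces where it is the RING-LEVEL formula `Ω[Γ(P.left, W)⁄k] ≃ (T ⊗_A Ω[Γ(Y.left, U)⁄k]) × (T ⊗_B Ω[Γ(Z.left, V)⁄k])` of
`Literature/Algebra/Derivations/KaehlerDifferentialTensorProduct.lean` (`KaehlerDifferential.tensorProductEquiv`,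
Eisenbud Prop. 16.5) through: `Γ(U, Ω¹_Y) = Ω[Γ(Y.left, U)⁄k]` on affine opens (`Motives.bijective_toCotangentSheaf_app_holds`,
Hartshorne II 8.9.2), `Γ(W, f^*Ω¹_Y) = T ⊗_A Γ(U, Ω¹_Y)` spanned by the `c • η(da)|_W`
(`HodgeTheory/CotangentSheafPullbackHomCharts.span_range_unitSectionLE_dSection_eq_top`, Hartshorne II 5.2 (e)) and
`df(c • η(da)|_W) = c • d(f♯a)` (`…pullbackHom_app_smul_unitSectionLE_dSection`); the one-factor statement is
`exists_baseChange_unitSectionLE` (the base change `λ : T ⊗_A Ω[A⁄k] → Γ(W, f^*Ω¹_Y)` of `ω ↦ η(ω)|_W` with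
`df ∘ λ = (KaehlerDifferential.mapBaseChange)~`). Proof: an explicit two-sided inverse
`Γ(W, Ω¹_P) ≅ Ω[Γ(P.left, W)⁄k] ≅ (T ⊗_A Ω[Γ(Y.left, U)⁄k]) × (T ⊗_B Ω[Γ(Z.left, V)⁄k]) → Γ(W, f^*Ω¹_Y) × Γ(W, g^*Ω¹_Z)`, the last arrow being the
base changes `c ⊗ ω ↦ c • η(ω)|_W` of `ω ↦ η(ω)|_W` (`IsBaseChange.lift`), both composites checked on generators.

The GLOBAL statement (`IsIso (biprod.desc (df) (dg))` for the product fan, via an affine product-chart cover and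
`Modules/IsoOfAffineCover`) is assembled elsewhere (`Motives/CotangentSheafProduct.lean`).

## References

* Q. Liu, *Algebraic Geometry and Arithmetic Curves*, OUP (2002), §6.1 Prop. 1.24 and Exercise 1.5. [Liu2002]
* D. Eisenbud, *Commutative Algebra with a View Toward Algebraic Geometry*, GTM 150 (1995), Prop. 16.5. [Eisenbud1995]
* R. Hartshorne, *Algebraic Geometry*, GTM 52 (1977), II Prop. 8.11, II Remark 8.9.2, II Prop. 5.2 (e). [Hartshorne1977]
-/

noncomputable section

-- `TopCat.Presheaf`/`Scheme.Modules` are not reducible (as in Mathlib's `AlgebraicGeometry/Modules/Sheaf.lean`).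
set_option backward.isDefEq.respectTransparency false

open CategoryTheory CategoryTheory.Limits AlgebraicGeometry Opposite TopologicalSpace TensorProduct

universe u

namespace Literature.AlgebraicGeometry.Motives

open Literature.AlgebraicGeometry.Modules Literature.AlgebraicGeometry.HodgeTheory

/-! ### One factor: the base change `c ⊗ ω ↦ c • η(ω)|_W` of `ω ↦ η(ω)|_W` and `dg` on it -/

section OneFactor

variable {k : Type u} [CommRing k] {X₀ X₁ : Over (Spec (CommRingCat.of k))} (g : X₀ ⟶ X₁)
  {V : X₁.left.Opens} (hV : IsAffineOpen V) {W : X₀.left.Opens} (i : W ≤ g.left ⁻¹ᵁ V)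

include hV in
/-- **The base change `λ : Γ(W) ⊗_{Γ(V)} Ω[Γ(V)⁄k] → Γ(W, g^*Ω¹_{X₁})`, `c ⊗ da ↦ c • η(da)|_W`, and `dg ∘ λ =` (base change
of Kähler differentials)**: for `W ⊆ g⁻¹V`, `V` affine, with the canonical algebra structures (`k → Γ(V)`, `k → Γ(W)` by the
structure morphisms, `Γ(V) → Γ(W)` by `g♯_{V→W}`) there is a `Γ(W)`-linear `λ` with `λ(c ⊗ da) = c • η(da)|_W` and
`dg(λ x) = (mapBaseChange x)~` in `Γ(W, Ω¹_{X₀})` (`~` = sheafification `toCotangentSheaf`, Hartshorne II 8.9.2), where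
Mathlib's `KaehlerDifferential.mapBaseChange : Γ(W) ⊗ Ω[Γ(V)⁄k] → Ω[Γ(W)⁄k]` is `c ⊗ da ↦ c • d(g♯a)`. `λ` is
`IsBaseChange.lift` of `ω ↦ η(ω̃)|_W` (`Γ(V, Ω¹) = Ω[Γ(V)⁄k]` on the affine `V`, `bijective_toCotangentSheaf_app_holds`).
[cite: Hartshorne1977, II Prop. 8.11 and II Prop. 5.2 (e)] [cite: Eisenbud1995, Prop. 16.4] -/
theorem exists_baseChange_unitSectionLE :
    letI : Algebra k Γ(X₁.left, V) := ((constToPresheaf X₁).app (op V)).hom.toAlgebra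
    letI : Algebra k Γ(X₀.left, W) := ((constToPresheaf X₀).app (op W)).hom.toAlgebra
    letI : Algebra Γ(X₁.left, V) Γ(X₀.left, W) := (g.left.appLE V W i).hom.toAlgebra
    ∀ [IsScalarTower k Γ(X₁.left, V) Γ(X₀.left, W)],
    ∃ lam : Γ(X₀.left, W) ⊗[Γ(X₁.left, V)] Ω[Γ(X₁.left, V)⁄k] →ₗ[Γ(X₀.left, W)]
        Γ((Scheme.Modules.pullback g.left).obj (cotangentSheaf X₁), W),
      (∀ (c : Γ(X₀.left, W)) (a : Γ(X₁.left, V)),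
          lam (c ⊗ₜ KaehlerDifferential.D k Γ(X₁.left, V) a) =
            c • unitSectionLE g.left (cotangentSheaf X₁) i (dSection X₁ V a)) ∧
      (∀ x, (cotangentSheaf.pullbackHom g).app W (lam x) =
          (toCotangentSheaf X₀).app (op W) (KaehlerDifferential.mapBaseChange k Γ(X₁.left, V) Γ(X₀.left, W) x)) := by
  letI algV : Algebra k Γ(X₁.left, V) := ((constToPresheaf X₁).app (op V)).hom.toAlgebra
  letI algW : Algebra k Γ(X₀.left, W) := ((constToPresheaf X₀).app (op W)).hom.toAlgebra
  letI algVW : Algebra Γ(X₁.left, V) Γ(X₀.left, W) := (g.left.appLE V W i).hom.toAlgebra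
  intro _
  let M := (Scheme.Modules.pullback g.left).obj (cotangentSheaf X₁)
  -- `Γ(V, Ω¹) = Ω[Γ(V)⁄k]`
  let θV : Ω[Γ(X₁.left, V)⁄k] ≃ₗ[Γ(X₁.left, V)] Γ(cotangentSheaf X₁, V) :=
    LinearEquiv.ofBijective ((toCotangentSheaf X₁).app (op V)).hom (bijective_toCotangentSheaf_app_holds X₁ hV)
  have hθV : ∀ a : Γ(X₁.left, V), θV (KaehlerDifferential.D k Γ(X₁.left, V) a) = dSection X₁ V a := fun a => rfl
  have hθW : ∀ (c : Γ(X₀.left, W)) (ξ : Ω[Γ(X₀.left, W)⁄k]),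
      (toCotangentSheaf X₀).app (op W) (c • ξ) = c • (toCotangentSheaf X₀).app (op W) ξ :=
    fun c ξ => ((toCotangentSheaf X₀).app (op W)).hom.map_smul c ξ
  -- `Γ(W, g^*Ω¹)` as a `Γ(V)`-module through `g♯`, and the `Γ(V)`-linear `ω ↦ η(θV ω)|_W`
  letI modV : Module Γ(X₁.left, V) Γ(M, W) := Module.compHom _ (g.left.appLE V W i).hom
  haveI towV : IsScalarTower Γ(X₁.left, V) Γ(X₀.left, W) Γ(M, W) :=
    IsScalarTower.of_algebraMap_smul fun (a : Γ(X₁.left, V)) (x : Γ(M, W)) => rfl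
  let μ : Ω[Γ(X₁.left, V)⁄k] →ₗ[Γ(X₁.left, V)] Γ(M, W) :=
    { toFun := fun ω => unitSectionLE g.left (cotangentSheaf X₁) i (θV ω)
      map_add' := fun ω ω' => by rw [map_add, unitSectionLE_add]
      map_smul' := fun a ω => by
        rw [LinearEquiv.map_smul, unitSectionLE_smul, RingHom.id_apply]
        rfl }
  let lam : Γ(X₀.left, W) ⊗[Γ(X₁.left, V)] Ω[Γ(X₁.left, V)⁄k] →ₗ[Γ(X₀.left, W)] Γ(M, W) :=
    (TensorProduct.isBaseChange Γ(X₁.left, V) Ω[Γ(X₁.left, V)⁄k] Γ(X₀.left, W)).lift μ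
  have lam_tmul : ∀ (c : Γ(X₀.left, W)) (ω : Ω[Γ(X₁.left, V)⁄k]),
      lam (c ⊗ₜ ω) = c • unitSectionLE g.left (cotangentSheaf X₁) i (θV ω) := fun c ω => by
    rw [show c ⊗ₜ[Γ(X₁.left, V)] ω = c • ((1 : Γ(X₀.left, W)) ⊗ₜ[Γ(X₁.left, V)] ω) by
        rw [TensorProduct.smul_tmul', smul_eq_mul, mul_one],
      map_smul]
    exact congrArg (c • ·) ((TensorProduct.isBaseChange Γ(X₁.left, V) Ω[Γ(X₁.left, V)⁄k] Γ(X₀.left, W)).lift_eq μ ω)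
  refine ⟨lam, fun c a => by rw [lam_tmul, hθV], fun x => ?_⟩
  induction x using TensorProduct.induction_on with
  | zero => simp only [map_zero]
  | add x y hx hy => simp only [map_add, hx, hy]
  | tmul c ω =>
    have hω : ω ∈ Submodule.span Γ(X₁.left, V) (Set.range (KaehlerDifferential.D k Γ(X₁.left, V))) := by
      rw [KaehlerDifferential.span_range_derivation]; exact Submodule.mem_top
    induction hω using Submodule.span_induction generalizing c with
    | mem y hy =>
      obtain ⟨a, rfl⟩ := hy
      rw [lam_tmul, KaehlerDifferential.mapBaseChange_tmul, KaehlerDifferential.map_D, hθV, hθW]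
      exact cotangentSheaf.pullbackHom_app_smul_unitSectionLE_dSection g i c a
    | zero => simp only [TensorProduct.tmul_zero, map_zero]
    | add y z _ _ hy hz => simp only [TensorProduct.tmul_add, map_add, hy, hz]
    | smul a y _ hy => rw [← TensorProduct.smul_tmul]; exact hy (a • c)

end OneFactor

/-! ### The chart bijectivity -/

section Chart

variable {k : Type u} [CommRing k] {P Y Z : Over (Spec (CommRingCat.of k))} (f : P ⟶ Y) (g : P ⟶ Z)
  {U : Y.left.Opens} (hU : IsAffineOpen U) {V : Z.left.Opens} (hV : IsAffineOpen V)
  {W : P.left.Opens} (hW : IsAffineOpen W) (iU : W ≤ f.left ⁻¹ᵁ U) (iV : W ≤ g.left ⁻¹ᵁ V)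

set_option maxHeartbeats 400000 in
include hU hV hW in
/-- **The product formula for `Ω¹` on an affine product chart** (sum form). Let `f : P ⟶ Y`, `g : P ⟶ Z` be
morphisms of `k`-schemes and `U ⊆ Y`, `V ⊆ Z`, `W ⊆ P` affine opens with `W ⊆ f⁻¹U ∩ g⁻¹V` such that
`Γ(W, 𝒪_P)` is a pushout `Γ(U, 𝒪_Y) ⊗_k Γ(V, 𝒪_Z)` for the algebra structures given by the structure morphisms
and `f♯_{U→W}`, `g♯_{V→W}`. Then `Γ(W, f^*Ω¹_Y) × Γ(W, g^*Ω¹_Z) → Γ(W, Ω¹_P)`, `(x, y) ↦ df(x) + dg(y)`, is bijective —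
the ring-level product formula `Ω[Γ(P.left, W)⁄k] ≃ (T ⊗_A Ω[Γ(Y.left, U)⁄k]) × (T ⊗_B Ω[Γ(Z.left, V)⁄k])` read in the sheaves.
[cite: Liu2002, §6.1 Exercise 1.5 (b)] [cite: Eisenbud1995, Prop. 16.5] -/
theorem bijective_pullbackHom_app_add_pullbackHom_app
    [Algebra k Γ(Y.left, U)] [Algebra k Γ(Z.left, V)] [Algebra k Γ(P.left, W)]
    [Algebra Γ(Y.left, U) Γ(P.left, W)] [Algebra Γ(Z.left, V) Γ(P.left, W)]
    [IsScalarTower k Γ(Y.left, U) Γ(P.left, W)] [IsScalarTower k Γ(Z.left, V) Γ(P.left, W)]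
    [Algebra.IsPushout k Γ(Y.left, U) Γ(Z.left, V) Γ(P.left, W)]
    (hkU : algebraMap k Γ(Y.left, U) = ((constToPresheaf Y).app (op U)).hom)
    (hkV : algebraMap k Γ(Z.left, V) = ((constToPresheaf Z).app (op V)).hom)
    (hkW : algebraMap k Γ(P.left, W) = ((constToPresheaf P).app (op W)).hom)
    (hUW : algebraMap Γ(Y.left, U) Γ(P.left, W) = (f.left.appLE U W iU).hom)
    (hVW : algebraMap Γ(Z.left, V) Γ(P.left, W) = (g.left.appLE V W iV).hom) :
    Function.Bijective fun p :
        Γ((Scheme.Modules.pullback f.left).obj (cotangentSheaf Y), W) ×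
          Γ((Scheme.Modules.pullback g.left).obj (cotangentSheaf Z), W) =>
      (cotangentSheaf.pullbackHom f).app W p.1 + (cotangentSheaf.pullbackHom g).app W p.2 := by
  -- normalise the algebra structures to the canonical ones (they are determined by their `algebraMap`s)
  obtain rfl : ‹Algebra k Γ(Y.left, U)› = ((constToPresheaf Y).app (op U)).hom.toAlgebra :=
    Algebra.algebra_ext _ _ fun r => by rw [hkU]; rfl
  obtain rfl : ‹Algebra k Γ(Z.left, V)› = ((constToPresheaf Z).app (op V)).hom.toAlgebra :=
    Algebra.algebra_ext _ _ fun r => by rw [hkV]; rfl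
  obtain rfl : ‹Algebra k Γ(P.left, W)› = ((constToPresheaf P).app (op W)).hom.toAlgebra :=
    Algebra.algebra_ext _ _ fun r => by rw [hkW]; rfl
  obtain rfl : ‹Algebra Γ(Y.left, U) Γ(P.left, W)› = (f.left.appLE U W iU).hom.toAlgebra :=
    Algebra.algebra_ext _ _ fun r => by rw [hUW]; rfl
  obtain rfl : ‹Algebra Γ(Z.left, V) Γ(P.left, W)› = (g.left.appLE V W iV).hom.toAlgebra :=
    Algebra.algebra_ext _ _ fun r => by rw [hVW]; rfl
  letI algA : Algebra k Γ(Y.left, U) := ((constToPresheaf Y).app (op U)).hom.toAlgebra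
  letI algB : Algebra k Γ(Z.left, V) := ((constToPresheaf Z).app (op V)).hom.toAlgebra
  letI algT : Algebra k Γ(P.left, W) := ((constToPresheaf P).app (op W)).hom.toAlgebra
  letI algAT : Algebra Γ(Y.left, U) Γ(P.left, W) := (f.left.appLE U W iU).hom.toAlgebra
  letI algBT : Algebra Γ(Z.left, V) Γ(P.left, W) := (g.left.appLE V W iV).hom.toAlgebra
  -- the two pulled-back modules and `df`, `dg` on `Γ(W, –)` as `Γ(W)`-linear maps
  let MU := (Scheme.Modules.pullback f.left).obj (cotangentSheaf Y)
  let MV := (Scheme.Modules.pullback g.left).obj (cotangentSheaf Z)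
  let φU : Γ(MU, W) →ₗ[Γ(P.left, W)] Γ(cotangentSheaf P, W) :=
    { toFun := fun x => (cotangentSheaf.pullbackHom f).app W x
      map_add' := fun x y => map_add _ x y
      map_smul' := fun c x => Scheme.Modules.Hom.app_smul _ _ _ }
  let φV : Γ(MV, W) →ₗ[Γ(P.left, W)] Γ(cotangentSheaf P, W) :=
    { toFun := fun x => (cotangentSheaf.pullbackHom g).app W x
      map_add' := fun x y => map_add _ x y
      map_smul' := fun c x => Scheme.Modules.Hom.app_smul _ _ _ }
  have hφU : ∀ x, φU x = (cotangentSheaf.pullbackHom f).app W x := fun x => rfl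
  have hφV : ∀ x, φV x = (cotangentSheaf.pullbackHom g).app W x := fun x => rfl
  -- `Γ(W, Ω¹_P) = Ω[Γ(W)⁄k]`
  let θW : Ω[Γ(P.left, W)⁄k] ≃ₗ[Γ(P.left, W)] Γ(cotangentSheaf P, W) :=
    LinearEquiv.ofBijective ((toCotangentSheaf P).app (op W)).hom (bijective_toCotangentSheaf_app_holds P hW)
  have hθW : ∀ t : Γ(P.left, W), θW (KaehlerDifferential.D k Γ(P.left, W) t) = dSection P W t := fun t => rfl
  -- (1) the base changes `lamU`, `lamV` of `ω ↦ η(ω)|_W` with `df ∘ lamU = θW ∘ mapBaseChange` (one-factor lemma, twice)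
  obtain ⟨lamU, lamU_tmul, key_U⟩ := exists_baseChange_unitSectionLE f hU iU
  obtain ⟨lamV, lamV_tmul, key_V⟩ := exists_baseChange_unitSectionLE g hV iV
  replace key_U : ∀ x, φU (lamU x) = θW (KaehlerDifferential.mapBaseChange k Γ(Y.left, U) Γ(P.left, W) x) := key_U
  replace key_V : ∀ x, φV (lamV x) = θW (KaehlerDifferential.mapBaseChange k Γ(Z.left, V) Γ(P.left, W) x) := key_V
  -- the ring-level product formula on `Γ(W) = Γ(U) ⊗_k Γ(V)`, precomposed with `θW⁻¹`
  let E := Literature.Algebra.Derivations.KaehlerDifferential.tensorProductEquiv k Γ(Y.left, U) Γ(Z.left, V) Γ(P.left, W)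
  let ψ : Γ(cotangentSheaf P, W) →ₗ[Γ(P.left, W)]
      (Γ(P.left, W) ⊗[Γ(Y.left, U)] Ω[Γ(Y.left, U)⁄k]) × (Γ(P.left, W) ⊗[Γ(Z.left, V)] Ω[Γ(Z.left, V)⁄k]) :=
    E.toLinearMap ∘ₗ θW.symm.toLinearMap
  have hψ : ∀ ξ, ψ (θW ξ) = E ξ := fun ξ => by
    simp only [ψ, LinearMap.comp_apply, LinearEquiv.coe_toLinearMap, LinearEquiv.symm_apply_apply]
  -- the candidate inverse `L = (lamU × lamV) ∘ E ∘ θW⁻¹` (linear by construction) and the sum map `Σ`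
  let L : Γ(cotangentSheaf P, W) →ₗ[Γ(P.left, W)] Γ(MU, W) × Γ(MV, W) := (lamU.prodMap lamV) ∘ₗ ψ
  have hL : ∀ s, L s = (lamU (ψ s).1, lamV (ψ s).2) := fun s => rfl
  let sumMap : Γ(MU, W) × Γ(MV, W) → Γ(cotangentSheaf P, W) := fun p => φU p.1 + φV p.2
  -- (2) `Σ ∘ L = id`
  have hSL : ∀ s, sumMap (L s) = s := by
    intro s
    obtain ⟨ξ, rfl⟩ := θW.surjective s
    obtain ⟨⟨x, y⟩, rfl⟩ := E.symm.surjective ξ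
    have hExy : ψ (θW (E.symm (x, y))) = (x, y) := by rw [hψ, LinearEquiv.apply_symm_apply]
    change φU (lamU (ψ (θW (E.symm (x, y)))).1) + φV (lamV (ψ (θW (E.symm (x, y)))).2) = θW (E.symm (x, y))
    rw [hExy, key_U, key_V, ← map_add,
      ← Literature.Algebra.Derivations.KaehlerDifferential.tensorProductEquiv_symm_apply]
  -- (3) `L ∘ Σ = id`, checked on the generators `η(da)|_W`, `η(db)|_W` of the two factors
  have hLU : ∀ x : Γ(MU, W), L (φU x) = (x, 0) := by
    intro x
    have hx : x ∈ Submodule.span Γ(P.left, W) (Set.range fun a : Γ(Y.left, U) =>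
        unitSectionLE f.left (cotangentSheaf Y) iU (dSection Y U a)) := by
      rw [span_range_unitSectionLE_dSection_eq_top f hU hW iU]; exact Submodule.mem_top
    induction hx using Submodule.span_induction with
    | mem y hy =>
      obtain ⟨a, rfl⟩ := hy
      have h1 : φU (unitSectionLE f.left (cotangentSheaf Y) iU (dSection Y U a)) =
          θW (KaehlerDifferential.D k Γ(P.left, W) (algebraMap Γ(Y.left, U) Γ(P.left, W) a)) := by
        rw [hθW]
        exact cotangentSheaf.pullbackHom_app_unitSectionLE_dSection f iU a
      have h2 : ψ (φU (unitSectionLE f.left (cotangentSheaf Y) iU (dSection Y U a))) =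
          ((1 : Γ(P.left, W)) ⊗ₜ KaehlerDifferential.D k Γ(Y.left, U) a, 0) := by
        rw [h1, hψ]
        exact Literature.Algebra.Derivations.KaehlerDifferential.tensorProductEquiv_D_algebraMap_left k _ _ _ a
      rw [hL, h2, lamU_tmul, one_smul, map_zero]
    | zero => rw [map_zero, map_zero, Prod.zero_eq_mk]
    | add y z _ _ hy hz => rw [map_add, map_add, hy, hz, Prod.mk_add_mk, add_zero]
    | smul c y _ hy => rw [map_smul, map_smul, hy, Prod.smul_mk, smul_zero]
  have hLV : ∀ y : Γ(MV, W), L (φV y) = (0, y) := by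
    intro y
    have hy : y ∈ Submodule.span Γ(P.left, W) (Set.range fun b : Γ(Z.left, V) =>
        unitSectionLE g.left (cotangentSheaf Z) iV (dSection Z V b)) := by
      rw [span_range_unitSectionLE_dSection_eq_top g hV hW iV]; exact Submodule.mem_top
    induction hy using Submodule.span_induction with
    | mem y hy =>
      obtain ⟨b, rfl⟩ := hy
      have h1 : φV (unitSectionLE g.left (cotangentSheaf Z) iV (dSection Z V b)) =
          θW (KaehlerDifferential.D k Γ(P.left, W) (algebraMap Γ(Z.left, V) Γ(P.left, W) b)) := by
        rw [hθW]
        exact cotangentSheaf.pullbackHom_app_unitSectionLE_dSection g iV b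
      have h2 : ψ (φV (unitSectionLE g.left (cotangentSheaf Z) iV (dSection Z V b))) =
          (0, (1 : Γ(P.left, W)) ⊗ₜ KaehlerDifferential.D k Γ(Z.left, V) b) := by
        rw [h1, hψ]
        exact Literature.Algebra.Derivations.KaehlerDifferential.tensorProductEquiv_D_algebraMap_right k _ _ _ b
      rw [hL, h2, lamV_tmul, one_smul, map_zero]
    | zero => rw [map_zero, map_zero, Prod.zero_eq_mk]
    | add y z _ _ hy hz => rw [map_add, map_add, hy, hz, Prod.mk_add_mk, add_zero]
    | smul c y _ hy => rw [map_smul, map_smul, hy, Prod.smul_mk, smul_zero]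
  have hLS : ∀ p, L (sumMap p) = p := by
    rintro ⟨x, y⟩
    change L (φU x + φV y) = (x, y)
    rw [map_add, hLU, hLV, Prod.mk_add_mk, add_zero, zero_add]
  exact Function.bijective_iff_has_inverse.mpr ⟨L, hLS, hSL⟩

include hU hV hW in
/-- **The product formula for `Ω¹` on an affine product chart**: under the hypotheses of
`bijective_pullbackHom_app_add_pullbackHom_app` (`Γ(W, 𝒪_P) = Γ(U, 𝒪_Y) ⊗_k Γ(V, 𝒪_Z)` a pushout), the component
at `W` of `(df, dg) : f^*Ω¹_Y ⊞ g^*Ω¹_Z ⟶ Ω¹_P` is bijective (`Modules/BiprodSections.bijective_biprod_desc_app_iff`).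
[cite: Liu2002, §6.1 Exercise 1.5 (b)] [cite: Eisenbud1995, Prop. 16.5] -/
theorem bijective_biprod_desc_pullbackHom_app
    [Algebra k Γ(Y.left, U)] [Algebra k Γ(Z.left, V)] [Algebra k Γ(P.left, W)]
    [Algebra Γ(Y.left, U) Γ(P.left, W)] [Algebra Γ(Z.left, V) Γ(P.left, W)]
    [IsScalarTower k Γ(Y.left, U) Γ(P.left, W)] [IsScalarTower k Γ(Z.left, V) Γ(P.left, W)]
    [Algebra.IsPushout k Γ(Y.left, U) Γ(Z.left, V) Γ(P.left, W)]
    (hkU : algebraMap k Γ(Y.left, U) = ((constToPresheaf Y).app (op U)).hom)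
    (hkV : algebraMap k Γ(Z.left, V) = ((constToPresheaf Z).app (op V)).hom)
    (hkW : algebraMap k Γ(P.left, W) = ((constToPresheaf P).app (op W)).hom)
    (hUW : algebraMap Γ(Y.left, U) Γ(P.left, W) = (f.left.appLE U W iU).hom)
    (hVW : algebraMap Γ(Z.left, V) Γ(P.left, W) = (g.left.appLE V W iV).hom) :
    Function.Bijective
      ((biprod.desc (cotangentSheaf.pullbackHom f) (cotangentSheaf.pullbackHom g)).app W) :=
  (bijective_biprod_desc_app_iff W _ _).mpr
    (bijective_pullbackHom_app_add_pullbackHom_app f g hU hV hW iU iV hkU hkV hkW hUW hVW)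

/-! ### The same with the `k`-algebra structures pinned in the `ΓSpecIso ≫ appLE ⊤` normal form -/

omit hU hV hW in
/-- The structure map `k → Γ(U, 𝒪_X)` of `Motives.constToPresheaf` is `Γ(Spec k) → Γ(X, X) → Γ(X, U)`, i.e. the
normal form `(ΓSpecIso k)⁻¹ ≫ X.hom.appLE ⊤ U` used by `Motives/ProductAffineChart.exists_productChart` and
`Motives/ProductAffineChartCover`. [folklore] -/
private theorem constToPresheaf_app_eq_ΓSpecIso_inv_comp_appLE (X : Over (Spec (CommRingCat.of k)))
    (U' : X.left.Opens) :
    (constToPresheaf X).app (op U') = (Scheme.ΓSpecIso (CommRingCat.of k)).inv ≫ X.hom.appLE ⊤ U' le_top :=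
  rfl

include hU hV hW in
/-- **The product formula for `Ω¹` on an affine product chart**, with the three `k`-algebra structures pinned in
the normal form `algebraMap = ((ΓSpecIso k)⁻¹ ≫ X.hom.appLE ⊤ U)` of `Motives/ProductAffineChart.exists_productChart` ∕
`Motives/ProductAffineChartCover.isPushout_sections_fst_inf_snd` (the product-chart cover): the component at `W` of
`(df, dg) : f^*Ω¹_Y ⊞ g^*Ω¹_Z ⟶ Ω¹_P` is bijective. [cite: Liu2002, §6.1 Exercise 1.5 (b)] [cite: Eisenbud1995, Prop. 16.5] -/
theorem bijective_biprod_desc_pullbackHom_app_of_appLE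
    [Algebra k Γ(Y.left, U)] [Algebra k Γ(Z.left, V)] [Algebra k Γ(P.left, W)]
    [Algebra Γ(Y.left, U) Γ(P.left, W)] [Algebra Γ(Z.left, V) Γ(P.left, W)]
    [IsScalarTower k Γ(Y.left, U) Γ(P.left, W)] [IsScalarTower k Γ(Z.left, V) Γ(P.left, W)]
    [Algebra.IsPushout k Γ(Y.left, U) Γ(Z.left, V) Γ(P.left, W)]
    (hkU : algebraMap k Γ(Y.left, U) = ((Scheme.ΓSpecIso (CommRingCat.of k)).inv ≫ Y.hom.appLE ⊤ U le_top).hom)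
    (hkV : algebraMap k Γ(Z.left, V) = ((Scheme.ΓSpecIso (CommRingCat.of k)).inv ≫ Z.hom.appLE ⊤ V le_top).hom)
    (hkW : algebraMap k Γ(P.left, W) = ((Scheme.ΓSpecIso (CommRingCat.of k)).inv ≫ P.hom.appLE ⊤ W le_top).hom)
    (hUW : algebraMap Γ(Y.left, U) Γ(P.left, W) = (f.left.appLE U W iU).hom)
    (hVW : algebraMap Γ(Z.left, V) Γ(P.left, W) = (g.left.appLE V W iV).hom) :
    Function.Bijective
      ((biprod.desc (cotangentSheaf.pullbackHom f) (cotangentSheaf.pullbackHom g)).app W) :=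
  bijective_biprod_desc_pullbackHom_app f g hU hV hW iU iV
    (hkU.trans (by rw [constToPresheaf_app_eq_ΓSpecIso_inv_comp_appLE]))
    (hkV.trans (by rw [constToPresheaf_app_eq_ΓSpecIso_inv_comp_appLE]))
    (hkW.trans (by rw [constToPresheaf_app_eq_ΓSpecIso_inv_comp_appLE])) hUW hVW

end Chart

end Literature.AlgebraicGeometry.Motives

end
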